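import Summits.HodgeConjecture.HodgeConjecture.Theorems.CyclicUnitaryPowersCyclicSurfacePowersHodge
import Summits.HodgeConjecture.HodgeConjecture.Theorems.CyclicUnitaryPowersKatzGKR
import HarnessLib

/-!
# Route `CyclicUnitaryPowers` — the rung-F-H1 leaf `CyclicSurfacePowersHodge` (stmt-HodgeConjecture-19543) modulo SIX
# cited facts: the Goursat–Kolchin–Ribet debt is gone

`CyclicUnitaryPowersCyclicSurfacePowersHodge.cyclicSurfacePowersHodge_of_facts` closes the route's target modulo the
seven cited facts of crux K1.  The seventh, Katz's Goursat–Kolchin–Ribet criterion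
`Katz1990_goursatKolchinRibet_specialLinear'`, is now a THEOREM (`CyclicUnitaryPowersKatzGKR.stub_katzGKR`, from
`Literature/AlgebraicGeometry/HodgeTheory/GoursatKolchinRibetDischarge.lean`: Katz's proof over the tree's algebraic-group
library by prover-Ax with the classification of `Aut 𝔰𝔩ₙ` by prover-Bx).  So the leaf is conditional on exactly the SIX
geometric / Hodge-II facts: the Carlson–Toledo family and its eigenspace Hodge numbers (×3), Carlson–Toledo's
unitary-reflection density (Thm 7.1), Cattani–Deligne–Kaplan's algebraicity of the non-generic locus, André's normality
theorem.  CONDITIONAL result; nothing here says HC ∕ HC_AV is proved; rung F-H1 not moved.  Written by the prover seat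
`hodge-nonav-prover-Ax` (g3).

## References
* [CarlsonToledo1999] J. A. Carlson, D. Toledo, Duke Math. J. 97 (1999), §7 Theorem 7.1.
* [Andre1992] Y. André, Compositio Math. 82 (1992), Theorem 1.
* [Katz1990ESDE] N. M. Katz, Ann. of Math. Stud. 124 (1990), §1.8 Prop. 1.8.2.
-/

noncomputable section

open Literature.AlgebraicGeometry.Motives Literature.AlgebraicGeometry.HodgeTheory

-- mandated namespace `Summit.HodgeConjecture.HodgeConjecture.Theorems` trips `linter.dupNamespace` (off tree-wide)
set_option linter.dupNamespace false

namespace Summit.HodgeConjecture.HodgeConjecture.Theorems.CyclicUnitaryPowersCyclicSurfacePowersHodgeSixFacts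

open Summit.HodgeConjecture.HodgeConjecture.Theses.CyclicUnitaryPowers

/-- **The rung leaf `CyclicSurfacePowersHodge` modulo the six geometric / Hodge-II cited facts of K1** (Carlson–Toledo
×4, Cattani–Deligne–Kaplan, André) — Katz's Goursat–Kolchin–Ribet criterion being a theorem (`stub_katzGKR`).
[cite: CarlsonToledo1999, §7 Theorem 7.1 (p. 16)] [cite: Andre1992, Theorem 1] [cite: Katz1990ESDE, §1.8 Prop. 1.8.2] -/
theorem cyclicSurfacePowersHodge_of_six_facts
    (hCT : nonempty_carlsonToledoFamily) (hCT1 : carlsonToledo1999_finrank_eigenspace_deck_one)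
    (hCT2 : carlsonToledo1999_finrank_eigenspace_inf_hodgePiece)
    (hCDK : cmsp_nonHodgeGenericPoints_countable_algebraic_cover)
    (hAndre : andre1992_algebraicMonodromy_normal_mumfordTateGroup)
    (hCTd : carlsonToledo1999_unitaryReflection_zariskiDense) :
    CyclicSurfacePowersHodge :=
  CyclicUnitaryPowersCyclicSurfacePowersHodge.cyclicSurfacePowersHodge_of_veryGeneralDeckCommutatorsInHg
    (CyclicUnitaryPowersKatzGKR.veryGeneralDeckCommutatorsInHg_of_six_facts @hCT @hCT1 @hCT2 @hCDK @hAndre @hCTd)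

end Summit.HodgeConjecture.HodgeConjecture.Theorems.CyclicUnitaryPowersCyclicSurfacePowersHodgeSixFacts

end
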